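import Summits.Parity.BatemanHorn.Theses.RoughValueTransport
import Literature.NumberTheory.Sieve.BatemanHornProofs
import Summits.Parity.BatemanHorn.Theorems.RoughValueTransportRoughValueLawSieveBand
import Summits.Parity.BatemanHorn.Theorems.RoughValueTransportRoughValueLawMertensAlongSystem
import Summits.Parity.BatemanHorn.Theorems.RoughValueTransportRoughValueLawOmegaFacts
import Summits.Parity.BatemanHorn.Theorems.RoughValueTransportRoughValueLawRatioAnchoring
import HarnessLib

/-!
# Route `RoughValueTransport`, crux `RoughValueLaw` (stmt-Parity-11390), line `increment-anchoring`:
# the two open ratio laws imply the crux (direct half of the line's normal form)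

`--supports` file of the checked skeleton
`Summits/Parity/BatemanHorn/Cruxes/RoughValueLaw/Lines/increment-anchoring.lean`.  The line reduces
the crux `Summit.Parity.BatemanHorn.Theses.RoughValueTransport.RoughValueLaw` (for every Bateman–Horn
system `f` and every inline-Buchstab `ω` there is `A` with `Φ_f(x,u)(log x)^k/x → A(uω(u))^k` for all
`u > 2`) to two constant-free, existence-free RATIO laws split at depth `u = 3`, the registered OPEN
stubs `stub_deepRatioLaw` (S4: `Φ_f(x,u)/Φ_f(x,U) → ((uω(u))/(Uω(U)))^k`, `3 ≤ u < U`) and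
`stub_shallowRatioLaw` (S5: `Φ_f(x,u)/Φ_f(x,3) → ((1+log(u−1))/(1+log 2))^k`, `2 < u < 3`), using
four service stubs that are all LANDED:

* `stub_sieveBand` (`…RoughValueLawSieveBand.lean`) and `stub_mertensAlongSystem`
  (`…RoughValueLawMertensAlongSystem.lean`) — the two-sided fundamental lemma and Mertens along the
  system; glued here (`sieveAnchor_of_parts`) into the calibration band
  `Φ_f(x,U)(log x)^k/x ∈ [(1−ε),(1+ε)]·B(f)U^k`, `B(f) = (C(f)/∏deg fᵢ)e^{−kγ} > 0`, for `U ≥ U₁(ε)`;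
* `stub_omegaFacts` (`…RoughValueLawOmegaFacts.lean`) — `uω(u) = 1 + log(u−1)` on `[2,3]`, `ω → e^{−γ}`;
* `stub_ratioAnchoring` (`…RoughValueLawRatioAnchoring.lean`) — the transfer: band + ratio laws ⇒ rung
  limits with the FORCED constant `A = B(f)e^{kγ} = C(f)/∏deg fᵢ`.

This file PROVES the registered statement `roughValueLaw_of_ratioLaws : S4 → S5 → RoughValueLaw`
(composition `roughValueLaw_of_parts`: for `u ≥ 3` the transfer stub fed with the band, `ω → e^{−γ}`
and S4; for `2 < u < 3`, eventually `Φ(x,u)ℓ_x = [Φ(x,3)ℓ_x]·[Φ(x,u)/Φ(x,3)]` since `Φ(x,3) ≠ 0`, and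
`(3ω(3))^k·((1+log(u−1))/(1+log 2))^k = (uω(u))^k`).  With the sibling file
`RoughValueTransportRoughValueLawRatioLawsOfRoughValueLaw.lean` (`RoughValueLaw → S4 ∧ S5`) this is
the line's NORMAL FORM `RoughValueLaw ↔ S4 ∧ S5`: the open stubs are exactly the crux in projective
(constant-free) coordinates.  Everything used is PROVED in the tree; no definition, no named fact.
-/

namespace Summit.Parity.BatemanHorn.Cruxes.RoughValueLaw.IncrementAnchoring

open Filter Finset Polynomial
open scoped Topology BigOperators
open Literature.NumberTheory.Sieve

/-- **Glue for reshape 1: S1a + S1b ⇒ the planner's `stub_sieveAnchor` statement, verbatim.**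
Positivity of `B(f) = (C(f)/∏deg fᵢ)e^{−kγ}` is the PROVED `hasBatemanHornConst_holds` (`C(f) > 0`)
and `IsBatemanHornSystem.natDegree_pos`; the band: with `ε₁ = min(ε,1)/3`, eventually
`Φ = xV(1 ± ε₁)` (S1a) and `V(log x)^k = BU^k(1 ± ε₁)` (S1b), and `(1 ± ε₁)² ∈ [1 − ε, 1 + ε]`. [folklore] -/
theorem sieveAnchor_of_parts
    (hband : ∀ (k : ℕ) (f : Fin k → Polynomial ℤ), IsBatemanHornSystem f →
      ∀ ε : ℝ, 0 < ε → ∃ U₁ : ℝ, ∀ U : ℝ, U₁ ≤ U → ∀ᶠ x : ℕ in atTop,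
        |((((Icc 1 x).filter (fun n : ℕ => ∀ i, 0 < (f i).eval (n : ℤ) ∧
              ∀ p ∈ range ⌈(x : ℝ) ^ (((f i).natDegree : ℝ) / U)⌉₊,
                p.Prime → ¬ ((p : ℤ) ∣ (f i).eval (n : ℤ)))).card : ℝ) -
            (x : ℝ) * ∏ p ∈ Nat.primesBelow (x + 1),
              (1 - (((range p).filter (fun r : ℕ => ∃ i,
                  (p : ℝ) < (x : ℝ) ^ (((f i).natDegree : ℝ) / U) ∧
                    (p : ℤ) ∣ (f i).eval (r : ℤ))).card : ℝ) / (p : ℝ)))| ≤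
          ε * ((x : ℝ) * ∏ p ∈ Nat.primesBelow (x + 1),
              (1 - (((range p).filter (fun r : ℕ => ∃ i,
                  (p : ℝ) < (x : ℝ) ^ (((f i).natDegree : ℝ) / U) ∧
                    (p : ℤ) ∣ (f i).eval (r : ℤ))).card : ℝ) / (p : ℝ))))
    (hmert : ∀ (k : ℕ) (f : Fin k → Polynomial ℤ), IsBatemanHornSystem f →
      ∀ U : ℝ, ((∑ i, (f i).natDegree : ℕ) : ℝ) ≤ U →
        Tendsto (fun x : ℕ =>
          (∏ p ∈ Nat.primesBelow (x + 1),
              (1 - (((range p).filter (fun r : ℕ => ∃ i,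
                  (p : ℝ) < (x : ℝ) ^ (((f i).natDegree : ℝ) / U) ∧
                    (p : ℤ) ∣ (f i).eval (r : ℤ))).card : ℝ) / (p : ℝ))) * Real.log x ^ k)
          atTop
          (𝓝 (batemanHornConst f / (∏ i, ((f i).natDegree : ℝ)) *
            Real.exp (-((k : ℝ) * Real.eulerMascheroniConstant)) * U ^ k))) :
    ∀ (k : ℕ) (f : Fin k → Polynomial ℤ), IsBatemanHornSystem f →
      0 < batemanHornConst f / (∏ i, ((f i).natDegree : ℝ)) *
            Real.exp (-((k : ℝ) * Real.eulerMascheroniConstant)) ∧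
      ∀ ε : ℝ, 0 < ε → ∃ U₁ : ℝ, ∀ U : ℝ, U₁ ≤ U → ∀ᶠ x : ℕ in atTop,
        (1 - ε) * (batemanHornConst f / (∏ i, ((f i).natDegree : ℝ)) *
            Real.exp (-((k : ℝ) * Real.eulerMascheroniConstant)) * U ^ k) ≤
          (((Icc 1 x).filter (fun n : ℕ => ∀ i, 0 < (f i).eval (n : ℤ) ∧
              ∀ p ∈ range ⌈(x : ℝ) ^ (((f i).natDegree : ℝ) / U)⌉₊,
                p.Prime → ¬ ((p : ℤ) ∣ (f i).eval (n : ℤ)))).card : ℝ) * Real.log x ^ k / (x : ℝ) ∧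
        (((Icc 1 x).filter (fun n : ℕ => ∀ i, 0 < (f i).eval (n : ℤ) ∧
              ∀ p ∈ range ⌈(x : ℝ) ^ (((f i).natDegree : ℝ) / U)⌉₊,
                p.Prime → ¬ ((p : ℤ) ∣ (f i).eval (n : ℤ)))).card : ℝ) * Real.log x ^ k / (x : ℝ) ≤
          (1 + ε) * (batemanHornConst f / (∏ i, ((f i).natDegree : ℝ)) *
            Real.exp (-((k : ℝ) * Real.eulerMascheroniConstant)) * U ^ k) := by
  intro k f hf
  have hC : 0 < batemanHornConst f := (IsBatemanHornSystem.hasBatemanHornConst_holds hf).2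
  have hD : 0 < ∏ i, ((f i).natDegree : ℝ) :=
    Finset.prod_pos fun i _ => by exact_mod_cast hf.natDegree_pos i
  set B : ℝ := batemanHornConst f / (∏ i, ((f i).natDegree : ℝ)) *
      Real.exp (-((k : ℝ) * Real.eulerMascheroniConstant)) with hBdef
  have hB : 0 < B := mul_pos (div_pos hC hD) (Real.exp_pos _)
  refine ⟨hB, fun ε hε => ?_⟩
  set ε₁ : ℝ := min ε 1 / 3 with hε₁
  have hmin : 0 < min ε 1 := lt_min hε one_pos
  have hε₁pos : 0 < ε₁ := by rw [hε₁]; positivity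
  have hε₁le : 3 * ε₁ ≤ ε := by rw [hε₁]; linarith [min_le_left ε 1]
  have hε₁one : 3 * ε₁ ≤ 1 := by rw [hε₁]; linarith [min_le_right ε 1]
  obtain ⟨U₁, hU₁⟩ := hband k f hf ε₁ hε₁pos
  refine ⟨max U₁ (max (((∑ i, (f i).natDegree : ℕ) : ℝ)) 1), fun U hU => ?_⟩
  have hUU₁ : U₁ ≤ U := le_trans (le_max_left _ _) hU
  have hUdeg : (((∑ i, (f i).natDegree : ℕ) : ℝ)) ≤ U :=
    le_trans (le_trans (le_max_left _ _) (le_max_right _ _)) hU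
  have hU1 : (1 : ℝ) ≤ U := le_trans (le_trans (le_max_right _ _) (le_max_right _ _)) hU
  have hUpos : 0 < U := lt_of_lt_of_le one_pos hU1
  have hBU : 0 < B * U ^ k := mul_pos hB (pow_pos hUpos k)
  have h1 := hU₁ U hUU₁
  have h2 := hmert k f hf U hUdeg
  have h2' : ∀ᶠ x : ℕ in atTop,
      |(∏ p ∈ Nat.primesBelow (x + 1),
          (1 - (((range p).filter (fun r : ℕ => ∃ i,
              (p : ℝ) < (x : ℝ) ^ (((f i).natDegree : ℝ) / U) ∧
                (p : ℤ) ∣ (f i).eval (r : ℤ))).card : ℝ) / (p : ℝ))) * Real.log x ^ k -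
        B * U ^ k| ≤ ε₁ * (B * U ^ k) := by
    have hpos : 0 < ε₁ * (B * U ^ k) := mul_pos hε₁pos hBU
    filter_upwards [(Metric.tendsto_nhds.mp h2) (ε₁ * (B * U ^ k)) hpos] with x hx
    rw [Real.dist_eq] at hx
    exact hx.le
  have hx1 : ∀ᶠ x : ℕ in atTop, 1 ≤ x := eventually_ge_atTop 1
  filter_upwards [h1, h2', hx1] with x hR hV hx
  -- abbreviate
  set Φ : ℝ := (((Icc 1 x).filter (fun n : ℕ => ∀ i, 0 < (f i).eval (n : ℤ) ∧
      ∀ p ∈ range ⌈(x : ℝ) ^ (((f i).natDegree : ℝ) / U)⌉₊,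
        p.Prime → ¬ ((p : ℤ) ∣ (f i).eval (n : ℤ)))).card : ℝ) with hΦ
  set v : ℝ := ∏ p ∈ Nat.primesBelow (x + 1),
      (1 - (((range p).filter (fun r : ℕ => ∃ i,
          (p : ℝ) < (x : ℝ) ^ (((f i).natDegree : ℝ) / U) ∧
            (p : ℤ) ∣ (f i).eval (r : ℤ))).card : ℝ) / (p : ℝ)) with hv
  set L : ℝ := Real.log x ^ k with hL
  have hX : (0 : ℝ) < x := by exact_mod_cast hx
  have hL0 : 0 ≤ L := pow_nonneg (Real.log_nonneg (by exact_mod_cast hx)) k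
  -- from hV: (1 - ε₁) B U^k ≤ v L ≤ (1 + ε₁) B U^k, hence v L > 0, L > 0, v > 0
  have hV1 : (1 - ε₁) * (B * U ^ k) ≤ v * L := by
    have := (abs_le.mp hV).1; linarith
  have hV2 : v * L ≤ (1 + ε₁) * (B * U ^ k) := by
    have := (abs_le.mp hV).2; linarith
  have hvL : 0 < v * L := lt_of_lt_of_le (mul_pos (by linarith) hBU) hV1
  have hLpos : 0 < L := by
    rcases hL0.lt_or_eq with h | h
    · exact h
    · exfalso; rw [← h, mul_zero] at hvL; exact lt_irrefl _ hvL
  have hvpos : 0 < v := pos_of_mul_pos_left hvL hL0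
  have hxv : 0 < (x : ℝ) * v := mul_pos hX hvpos
  -- from hR: (1 - ε₁) x v ≤ Φ ≤ (1 + ε₁) x v
  have hR1 : (1 - ε₁) * ((x : ℝ) * v) ≤ Φ := by
    have := (abs_le.mp hR).1; linarith
  have hR2 : Φ ≤ (1 + ε₁) * ((x : ℝ) * v) := by
    have := (abs_le.mp hR).2; linarith
  -- Φ L / x = (Φ/(x v)) · (v L)
  have hkey : Φ * L / (x : ℝ) = Φ / ((x : ℝ) * v) * (v * L) := by
    field_simp
  rw [hkey]
  have hq1 : 1 - ε₁ ≤ Φ / ((x : ℝ) * v) := by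
    rw [le_div_iff₀ hxv]; exact hR1
  have hq2 : Φ / ((x : ℝ) * v) ≤ 1 + ε₁ := by
    rw [div_le_iff₀ hxv]; exact hR2
  have hq0 : 0 ≤ Φ / ((x : ℝ) * v) := le_trans (by linarith) hq1
  constructor
  · calc (1 - ε) * (B * U ^ k) ≤ (1 - ε₁) * ((1 - ε₁) * (B * U ^ k)) := by nlinarith
      _ ≤ Φ / ((x : ℝ) * v) * (v * L) :=
          mul_le_mul hq1 hV1 (le_of_lt (mul_pos (by linarith) hBU)) hq0
  · calc Φ / ((x : ℝ) * v) * (v * L) ≤ (1 + ε₁) * ((1 + ε₁) * (B * U ^ k)) :=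
          mul_le_mul hq2 hV2 hvL.le (by linarith)
      _ ≤ (1 + ε) * (B * U ^ k) := by nlinarith




/-- **Composition in hypothesis form** (the five stub STATEMENTS imply the crux BODY; clean axioms).
For `u ≥ 3`: S3 fed with S1, S2(b), S4.  For `2 < u < 3`: eventually
`Φ(x,u)ℓ_x = [Φ(x,3)ℓ_x]·[Φ(x,u)/Φ(x,3)]` (`Φ(x,3) ≠ 0` since its normalised limit is positive), the
limit is `B e^{kγ}(3ω(3))^k·((1+log(u−1))/(1+log 2))^k = B e^{kγ}(uω(u))^k` by S2(a). [folklore] -/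
theorem roughValueLaw_of_parts
    (h₁ : ∀ (k : ℕ) (f : Fin k → Polynomial ℤ), IsBatemanHornSystem f →
      0 < batemanHornConst f / (∏ i, ((f i).natDegree : ℝ)) *
            Real.exp (-((k : ℝ) * Real.eulerMascheroniConstant)) ∧
      ∀ ε : ℝ, 0 < ε → ∃ U₁ : ℝ, ∀ U : ℝ, U₁ ≤ U → ∀ᶠ x : ℕ in atTop,
        (1 - ε) * (batemanHornConst f / (∏ i, ((f i).natDegree : ℝ)) *
            Real.exp (-((k : ℝ) * Real.eulerMascheroniConstant)) * U ^ k) ≤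
          (((Icc 1 x).filter (fun n : ℕ => ∀ i, 0 < (f i).eval (n : ℤ) ∧
              ∀ p ∈ range ⌈(x : ℝ) ^ (((f i).natDegree : ℝ) / U)⌉₊,
                p.Prime → ¬ ((p : ℤ) ∣ (f i).eval (n : ℤ)))).card : ℝ) * Real.log x ^ k / (x : ℝ) ∧
        (((Icc 1 x).filter (fun n : ℕ => ∀ i, 0 < (f i).eval (n : ℤ) ∧
              ∀ p ∈ range ⌈(x : ℝ) ^ (((f i).natDegree : ℝ) / U)⌉₊,
                p.Prime → ¬ ((p : ℤ) ∣ (f i).eval (n : ℤ)))).card : ℝ) * Real.log x ^ k / (x : ℝ) ≤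
          (1 + ε) * (batemanHornConst f / (∏ i, ((f i).natDegree : ℝ)) *
            Real.exp (-((k : ℝ) * Real.eulerMascheroniConstant)) * U ^ k))
    (h₂ : ∀ ω : ℝ → ℝ, ((∀ u : ℝ, 1 ≤ u → u ≤ 2 → ω u = u⁻¹) ∧ ContinuousOn ω (Set.Ici 1) ∧
        (∀ u : ℝ, 2 < u → HasDerivAt (fun t : ℝ => t * ω t) (ω (u - 1)) u)) →
      (∀ u : ℝ, 2 ≤ u → u ≤ 3 → u * ω u = 1 + Real.log (u - 1)) ∧
      Tendsto ω atTop (𝓝 (Real.exp (-Real.eulerMascheroniConstant))))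
    (h₃ : ∀ (k : ℕ) (Φ : ℕ → ℝ → ℝ) (ω : ℝ → ℝ) (B u₀ : ℝ), 0 < B →
      Tendsto ω atTop (𝓝 (Real.exp (-Real.eulerMascheroniConstant))) →
      (∀ ε : ℝ, 0 < ε → ∃ U₁ : ℝ, ∀ U : ℝ, U₁ ≤ U → ∀ᶠ x : ℕ in atTop,
        (1 - ε) * (B * U ^ k) ≤ Φ x U * Real.log x ^ k / (x : ℝ) ∧
          Φ x U * Real.log x ^ k / (x : ℝ) ≤ (1 + ε) * (B * U ^ k)) →
      (∀ u U : ℝ, u₀ ≤ u → u < U →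
        Tendsto (fun x : ℕ => Φ x u / Φ x U) atTop (𝓝 ((u * ω u / (U * ω U)) ^ k))) →
      ∀ u : ℝ, u₀ ≤ u →
        Tendsto (fun x : ℕ => Φ x u * Real.log x ^ k / (x : ℝ)) atTop
          (𝓝 (B * Real.exp ((k : ℝ) * Real.eulerMascheroniConstant) * (u * ω u) ^ k)))
    (h₄ : ∀ (k : ℕ) (f : Fin k → Polynomial ℤ), IsBatemanHornSystem f → ∀ ω : ℝ → ℝ,
      ((∀ u : ℝ, 1 ≤ u → u ≤ 2 → ω u = u⁻¹) ∧ ContinuousOn ω (Set.Ici 1) ∧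
        (∀ u : ℝ, 2 < u → HasDerivAt (fun t : ℝ => t * ω t) (ω (u - 1)) u)) →
      ∀ u U : ℝ, 3 ≤ u → u < U →
        Tendsto (fun x : ℕ =>
          (((Icc 1 x).filter (fun n : ℕ => ∀ i, 0 < (f i).eval (n : ℤ) ∧
              ∀ p ∈ range ⌈(x : ℝ) ^ (((f i).natDegree : ℝ) / u)⌉₊,
                p.Prime → ¬ ((p : ℤ) ∣ (f i).eval (n : ℤ)))).card : ℝ) /
          (((Icc 1 x).filter (fun n : ℕ => ∀ i, 0 < (f i).eval (n : ℤ) ∧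
              ∀ p ∈ range ⌈(x : ℝ) ^ (((f i).natDegree : ℝ) / U)⌉₊,
                p.Prime → ¬ ((p : ℤ) ∣ (f i).eval (n : ℤ)))).card : ℝ)) atTop
          (𝓝 ((u * ω u / (U * ω U)) ^ k)))
    (h₅ : ∀ (k : ℕ) (f : Fin k → Polynomial ℤ), IsBatemanHornSystem f →
      ∀ u : ℝ, 2 < u → u < 3 →
        Tendsto (fun x : ℕ =>
          (((Icc 1 x).filter (fun n : ℕ => ∀ i, 0 < (f i).eval (n : ℤ) ∧
              ∀ p ∈ range ⌈(x : ℝ) ^ (((f i).natDegree : ℝ) / u)⌉₊,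
                p.Prime → ¬ ((p : ℤ) ∣ (f i).eval (n : ℤ)))).card : ℝ) /
          (((Icc 1 x).filter (fun n : ℕ => ∀ i, 0 < (f i).eval (n : ℤ) ∧
              ∀ p ∈ range ⌈(x : ℝ) ^ (((f i).natDegree : ℝ) / 3)⌉₊,
                p.Prime → ¬ ((p : ℤ) ∣ (f i).eval (n : ℤ)))).card : ℝ)) atTop
          (𝓝 (((1 + Real.log (u - 1)) / (1 + Real.log 2)) ^ k))) :
    ∀ (k : ℕ) (f : Fin k → Polynomial ℤ), Literature.NumberTheory.Sieve.IsBatemanHornSystem f →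
      ∀ ω : ℝ → ℝ, ((∀ u : ℝ, 1 ≤ u → u ≤ 2 → ω u = u⁻¹) ∧ ContinuousOn ω (Set.Ici 1) ∧
        (∀ u : ℝ, 2 < u → HasDerivAt (fun t : ℝ => t * ω t) (ω (u - 1)) u)) →
      ∃ A : ℝ, ∀ u : ℝ, 2 < u → Filter.Tendsto (fun x : ℕ =>
        (((Finset.Icc 1 x).filter (fun n : ℕ => ∀ i, 0 < (f i).eval (n : ℤ) ∧
          ∀ p ∈ Finset.range ⌈(x : ℝ) ^ (((f i).natDegree : ℝ) / u)⌉₊,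
            p.Prime → ¬ ((p : ℤ) ∣ (f i).eval (n : ℤ)))).card : ℝ) * Real.log x ^ k / (x : ℝ))
        Filter.atTop (nhds (A * (u * ω u) ^ k)) := by
  intro k f hf ω hω
  obtain ⟨hB, hband⟩ := h₁ k f hf
  obtain ⟨h23, hlim⟩ := h₂ ω hω
  -- the rungs `u ≥ 3`: the transfer stub fed with S1, S2(b), S4
  have hdeep := h₃ k (fun (x : ℕ) (u : ℝ) =>
      (((Icc 1 x).filter (fun n : ℕ => ∀ i, 0 < (f i).eval (n : ℤ) ∧
        ∀ p ∈ range ⌈(x : ℝ) ^ (((f i).natDegree : ℝ) / u)⌉₊,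
          p.Prime → ¬ ((p : ℤ) ∣ (f i).eval (n : ℤ)))).card : ℝ)) ω _ 3 hB hlim hband (h₄ k f hf ω hω)
  refine ⟨batemanHornConst f / (∏ i, ((f i).natDegree : ℝ)) *
      Real.exp (-((k : ℝ) * Real.eulerMascheroniConstant)) *
      Real.exp ((k : ℝ) * Real.eulerMascheroniConstant), fun u hu => ?_⟩
  by_cases h3u : 3 ≤ u
  · exact hdeep u h3u
  · have h3u : u < 3 := not_le.mp h3u
    have hthree := hdeep 3 le_rfl
    have hrat := h₅ k f hf u hu h3u
    have h3ω : (3 : ℝ) * ω 3 = 1 + Real.log 2 := by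
      have h := h23 3 (by norm_num) le_rfl
      rwa [show (3 : ℝ) - 1 = 2 by norm_num] at h
    have huω : u * ω u = 1 + Real.log (u - 1) := h23 u hu.le h3u.le
    have hlog2 : 0 < 1 + Real.log 2 := by
      have := Real.log_pos (by norm_num : (1 : ℝ) < 2)
      linarith
    have hL3pos : 0 < batemanHornConst f / (∏ i, ((f i).natDegree : ℝ)) *
        Real.exp (-((k : ℝ) * Real.eulerMascheroniConstant)) *
        Real.exp ((k : ℝ) * Real.eulerMascheroniConstant) * ((3 : ℝ) * ω 3) ^ k := by
      rw [h3ω]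
      exact mul_pos (mul_pos hB (Real.exp_pos _)) (pow_pos hlog2 k)
    -- eventually the rung-3 count is nonzero
    have hne : ∀ᶠ x : ℕ in atTop,
        (((Icc 1 x).filter (fun n : ℕ => ∀ i, 0 < (f i).eval (n : ℤ) ∧
          ∀ p ∈ range ⌈(x : ℝ) ^ (((f i).natDegree : ℝ) / 3)⌉₊,
            p.Prime → ¬ ((p : ℤ) ∣ (f i).eval (n : ℤ)))).card : ℝ) ≠ 0 := by
      have hev := hthree.eventually (lt_mem_nhds hL3pos)
      filter_upwards [hev] with x hx
      intro h0
      beta_reduce at hx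
      rw [h0, zero_mul, zero_div] at hx
      exact lt_irrefl _ hx
    have hprod := hthree.mul hrat
    have key : Tendsto (fun x : ℕ =>
        (((Icc 1 x).filter (fun n : ℕ => ∀ i, 0 < (f i).eval (n : ℤ) ∧
          ∀ p ∈ range ⌈(x : ℝ) ^ (((f i).natDegree : ℝ) / u)⌉₊,
            p.Prime → ¬ ((p : ℤ) ∣ (f i).eval (n : ℤ)))).card : ℝ) * Real.log x ^ k / (x : ℝ))
        atTop (𝓝 (batemanHornConst f / (∏ i, ((f i).natDegree : ℝ)) *
          Real.exp (-((k : ℝ) * Real.eulerMascheroniConstant)) *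
          Real.exp ((k : ℝ) * Real.eulerMascheroniConstant) * ((3 : ℝ) * ω 3) ^ k *
          (((1 + Real.log (u - 1)) / (1 + Real.log 2)) ^ k))) := by
      refine hprod.congr' ?_
      filter_upwards [hne] with x hx
      beta_reduce
      calc (((Icc 1 x).filter (fun n : ℕ => ∀ i, 0 < (f i).eval (n : ℤ) ∧
              ∀ p ∈ range ⌈(x : ℝ) ^ (((f i).natDegree : ℝ) / 3)⌉₊,
                p.Prime → ¬ ((p : ℤ) ∣ (f i).eval (n : ℤ)))).card : ℝ) * Real.log x ^ k / (x : ℝ) *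
            ((((Icc 1 x).filter (fun n : ℕ => ∀ i, 0 < (f i).eval (n : ℤ) ∧
              ∀ p ∈ range ⌈(x : ℝ) ^ (((f i).natDegree : ℝ) / u)⌉₊,
                p.Prime → ¬ ((p : ℤ) ∣ (f i).eval (n : ℤ)))).card : ℝ) /
            (((Icc 1 x).filter (fun n : ℕ => ∀ i, 0 < (f i).eval (n : ℤ) ∧
              ∀ p ∈ range ⌈(x : ℝ) ^ (((f i).natDegree : ℝ) / 3)⌉₊,
                p.Prime → ¬ ((p : ℤ) ∣ (f i).eval (n : ℤ)))).card : ℝ))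
          = ((((Icc 1 x).filter (fun n : ℕ => ∀ i, 0 < (f i).eval (n : ℤ) ∧
              ∀ p ∈ range ⌈(x : ℝ) ^ (((f i).natDegree : ℝ) / 3)⌉₊,
                p.Prime → ¬ ((p : ℤ) ∣ (f i).eval (n : ℤ)))).card : ℝ) /
            (((Icc 1 x).filter (fun n : ℕ => ∀ i, 0 < (f i).eval (n : ℤ) ∧
              ∀ p ∈ range ⌈(x : ℝ) ^ (((f i).natDegree : ℝ) / 3)⌉₊,
                p.Prime → ¬ ((p : ℤ) ∣ (f i).eval (n : ℤ)))).card : ℝ)) *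
            ((((Icc 1 x).filter (fun n : ℕ => ∀ i, 0 < (f i).eval (n : ℤ) ∧
              ∀ p ∈ range ⌈(x : ℝ) ^ (((f i).natDegree : ℝ) / u)⌉₊,
                p.Prime → ¬ ((p : ℤ) ∣ (f i).eval (n : ℤ)))).card : ℝ) * Real.log x ^ k / (x : ℝ)) := by
            ring
        _ = (((Icc 1 x).filter (fun n : ℕ => ∀ i, 0 < (f i).eval (n : ℤ) ∧
              ∀ p ∈ range ⌈(x : ℝ) ^ (((f i).natDegree : ℝ) / u)⌉₊,
                p.Prime → ¬ ((p : ℤ) ∣ (f i).eval (n : ℤ)))).card : ℝ) * Real.log x ^ k / (x : ℝ) := by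
            rw [div_self hx, one_mul]
    have hV : batemanHornConst f / (∏ i, ((f i).natDegree : ℝ)) *
          Real.exp (-((k : ℝ) * Real.eulerMascheroniConstant)) *
          Real.exp ((k : ℝ) * Real.eulerMascheroniConstant) * ((3 : ℝ) * ω 3) ^ k *
          (((1 + Real.log (u - 1)) / (1 + Real.log 2)) ^ k) =
        batemanHornConst f / (∏ i, ((f i).natDegree : ℝ)) *
          Real.exp (-((k : ℝ) * Real.eulerMascheroniConstant)) *
          Real.exp ((k : ℝ) * Real.eulerMascheroniConstant) * (u * ω u) ^ k := by
      have hne2 : (1 + Real.log 2) ^ k ≠ 0 := pow_ne_zero k hlog2.ne'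
      rw [h3ω, huω, div_pow, mul_assoc _ ((1 + Real.log 2) ^ k), mul_div_cancel₀ _ hne2]
    rw [hV] at key
    exact key


/-- **The two open ratio laws imply the crux** (registered statement
`roughValueLaw_of_ratioLaws` of crux stmt-Parity-11390, line `increment-anchoring`): S4 (deep
ratios, `3 ≤ u < U`) and S5 (shallow ratios against the rung `3`, `2 < u < 3`) give
`Summit.Parity.BatemanHorn.Theses.RoughValueTransport.RoughValueLaw`, with the constant
`A = C(f)/∏deg fᵢ` forced by the landed calibration.  [folklore] -/
theorem roughValueLaw_of_ratioLaws :
    (∀ (k : ℕ) (f : Fin k → Polynomial ℤ), IsBatemanHornSystem f → ∀ ω : ℝ → ℝ,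
      ((∀ u : ℝ, 1 ≤ u → u ≤ 2 → ω u = u⁻¹) ∧ ContinuousOn ω (Set.Ici 1) ∧
        (∀ u : ℝ, 2 < u → HasDerivAt (fun t : ℝ => t * ω t) (ω (u - 1)) u)) →
      ∀ u U : ℝ, 3 ≤ u → u < U →
        Tendsto (fun x : ℕ =>
          (((Icc 1 x).filter (fun n : ℕ => ∀ i, 0 < (f i).eval (n : ℤ) ∧
              ∀ p ∈ range ⌈(x : ℝ) ^ (((f i).natDegree : ℝ) / u)⌉₊,
                p.Prime → ¬ ((p : ℤ) ∣ (f i).eval (n : ℤ)))).card : ℝ) /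
          (((Icc 1 x).filter (fun n : ℕ => ∀ i, 0 < (f i).eval (n : ℤ) ∧
              ∀ p ∈ range ⌈(x : ℝ) ^ (((f i).natDegree : ℝ) / U)⌉₊,
                p.Prime → ¬ ((p : ℤ) ∣ (f i).eval (n : ℤ)))).card : ℝ)) atTop
          (𝓝 ((u * ω u / (U * ω U)) ^ k))) →
    (∀ (k : ℕ) (f : Fin k → Polynomial ℤ), IsBatemanHornSystem f →
      ∀ u : ℝ, 2 < u → u < 3 →
        Tendsto (fun x : ℕ =>
          (((Icc 1 x).filter (fun n : ℕ => ∀ i, 0 < (f i).eval (n : ℤ) ∧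
              ∀ p ∈ range ⌈(x : ℝ) ^ (((f i).natDegree : ℝ) / u)⌉₊,
                p.Prime → ¬ ((p : ℤ) ∣ (f i).eval (n : ℤ)))).card : ℝ) /
          (((Icc 1 x).filter (fun n : ℕ => ∀ i, 0 < (f i).eval (n : ℤ) ∧
              ∀ p ∈ range ⌈(x : ℝ) ^ (((f i).natDegree : ℝ) / 3)⌉₊,
                p.Prime → ¬ ((p : ℤ) ∣ (f i).eval (n : ℤ)))).card : ℝ)) atTop
          (𝓝 (((1 + Real.log (u - 1)) / (1 + Real.log 2)) ^ k))) →
    Summit.Parity.BatemanHorn.Theses.RoughValueTransport.RoughValueLaw :=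
  fun h₄ h₅ => roughValueLaw_of_parts (sieveAnchor_of_parts stub_sieveBand stub_mertensAlongSystem)
    stub_omegaFacts stub_ratioAnchoring h₄ h₅

end Summit.Parity.BatemanHorn.Cruxes.RoughValueLaw.IncrementAnchoring
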